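import Summits.QuantumFields.YangMills.Theorems.BalabanLadderIRcofEquipartitionSeamKernelDefs
import Summits.QuantumFields.YangMills.Theorems.BalabanLadderIRcofThickSpeciesDatum
import HarnessLib

/-!
# Line `equipartition_seam`, rev 8 (β) — BRIDGES, part 1: family bookkeeping, PEELING in the `w`-theory, transport algebra (0 sorry)

Helper for crux `IRcof` (stmt-QuantumFields-26930), census row 47 «equipartition-seam» (ideator ym-ir-idea-22 g6, critic ym-ir-crit-3 g5; bridge
signatures B1 ∕ B2 KEYED to the pool prover, bus l.1607; typing repairs R1 ∕ `0 ≤ nrm A` ∕ (N-b) endorsed l.≈1616 and adopted in the landed defs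
module `Theorems/BalabanLadderIRcofEquipartitionSeamKernelDefs.lean`, p687323 + p687588).  This file holds everything the two bridges need
except the bridges themselves (part 2, `…KernelBridges.lean`):

* `withEl_elPart_eq` — ELECTRICALLY RELATED sectors (`z q = z' q` off the time planes) lie in one electric family: `z = withEl z' (elPart z)`;
  `withEl_related`, `secZ_nonneg` (`w ≥ 0`, clause 2 of `TwistSplitWeight`).
* `abs_sub_le_of_noise_of_window` — B1's ε-lemma: label noise `ν = e^{−t}/8` + window EQUI `e^{−(t+1)}` ⟹ `|p − q| ≤ e^{−t}·q`.
* ★ `canonical_eblind` — PEELING in the `w`-theory: for `S ≥ max(S_e, S_T, S_D, 1)` and `4·thick A ≤ 2S+1`,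
  `|W_A(z₀|e)·Z(z₀|e') − W_A(z₀|e')·Z(z₀|e)| ≤ 40·(nrm A·C_T)·e^{−(2S+2)}·Z(z₀|e)·Z(z₀|e')` — the tree theorem
  `ThickSpeciesDatum.eblind_thick_re` (p685489) over `Zc := Fin 3 → ker π` (abelian by `ker π ≤ center`, finite by `(ker π).Finite`), fed with
  D's eigen-datum at extents `2S+1−thick A` and `2S+1`, S3ʷ at both extents (rate `e^{−(2S+2)} ≤ 1/2`) and T's slack at `ϱ = thick A`.
* `abs_secW_le` — `|W_A(z₀|e)| ≤ 2·(nrm A·C_T)·Z(z₀|e)`; `nrm_nonneg_of_spectralDictOn`.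
* `cross_transport` — pure real bookkeeping through the label noise (the dressing constant `J`, anchored on the weight, cancels identically):
  `|p'·I − p·I'| ≤ 2·(M + 4Kν + 4Cν)·p·p'` for `ν ≤ 1/8`.

HONEST: bookkeeping between OPEN located stubs (S1, S3ʷ, T, D, N, S5ᵛ untouched); registry rev 7 unchanged; width toward PXcof ∕ N_cof ∕ `IRcof` ∕
`IR` 0; the Yang–Mills mass gap (Clay) is NOT proved anywhere in this tree; R4 closes only the conditional finite-𝕋⁴ rung `BalabanLadder.UV`.
Written by pool prover ym-ir-line-pool-p3 g16.
-/

set_option autoImplicit false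

noncomputable section

open MeasureTheory Filter Topology
open Literature.MathematicalPhysics.QuantumFieldTheory Literature.MathematicalPhysics.QuantumLattice
open Summit.QuantumFields.YangMills.Theorems.NonSimplyConnectedLatticeGap

namespace Summit.QuantumFields.YangMills.Cruxes.IRcof.EquipartitionSeam.KernelBridges

open KernelCurrency

section Family

variable {G H : Type} [Group G] [Group H]

/-- Two ELECTRICALLY RELATED sectors (`z q = z' q` off the time planes) lie in one electric family: `z = withEl z' (elPart z)`. -/
theorem withEl_elPart_eq (π : H →* G) {z z' : Sector π} (hrel : ∀ q : Plane, q.1.1 ≠ 0 → z q = z' q) :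
    withEl π z' (elPart π z) = z := by
  funext q
  unfold withEl
  split_ifs with h
  · unfold elPart
    congr 1
    apply Subtype.ext
    have hlt : (q.1.1 : ℕ) < (q.1.2 : ℕ) := q.2
    have h0 : (q.1.1 : ℕ) = 0 := by rw [h]; rfl
    refine Prod.ext ?_ ?_
    · simpa using h.symm
    · apply Fin.ext
      simp only [Fin.val_succ]
      omega
  · exact (hrel q h).symm

/-- In particular every sector is `withEl` of itself and its own electric part. -/
theorem withEl_elPart_self (π : H →* G) (z : Sector π) : withEl π z (elPart π z) = z :=
  withEl_elPart_eq π (fun _ _ => rfl)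

/-- Members of one electric family are electrically related. -/
theorem withEl_related (π : H →* G) (z : Sector π) (e e' : Fin 3 → ↥π.ker) :
    ∀ q : Plane, q.1.1 ≠ 0 → withEl π z e q = withEl π z e' q := by
  intro q hq
  unfold withEl
  rw [if_neg hq, if_neg hq]

variable [TopologicalSpace H] [IsTopologicalGroup H] [CompactSpace H] [MeasurableSpace H] [BorelSpace H]

/-- The `w`-theory partition functions are non-negative for a non-negative plaquette weight. -/
theorem secZ_nonneg (π : H →* G) {w : H → ℝ} (hw : ∀ h, 0 ≤ w h) (z : Sector π) (S s : ℕ) : 0 ≤ secZ π w z S s := by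
  unfold secZ
  exact integral_nonneg fun U => Finset.prod_nonneg fun x _ => Finset.prod_nonneg fun q _ => hw _

end Family

/-! ## The numeric step of B1 -/

/-- **B1's ε-bookkeeping.**  Weights `p, q ≥ 0`, canonical partition functions `Zp, Zq ≥ 0`, a normalisation `N > 0`, the label noise
`|p − N·Zp| ≤ ν·N·Zp`, `|q − N·Zq| ≤ ν·N·Zq` with `ν = e^{−t}/8`, and the window equipartition `|Zp − Zq| ≤ e^{−(t+1)}·Zq` give
`|p − q| ≤ e^{−t}·q` (indeed `≤ (13/14)·e^{−t}·q`: `2ν + η + νη ≤ (1/4 + 1/2 + 1/16)e^{−t}` with `η = e^{−t−1} ≤ e^{−t}/2`, and `q ≥ (7/8)·N·Zq`). -/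
theorem abs_sub_le_of_noise_of_window {p q Zp Zq N t : ℝ} (hZp : 0 ≤ Zp) (hZq : 0 ≤ Zq) (hN : 0 < N) (ht : 0 ≤ t)
    (hp : |p - N * Zp| ≤ Real.exp (-t) / 8 * (N * Zp)) (hq : |q - N * Zq| ≤ Real.exp (-t) / 8 * (N * Zq))
    (hZ : |Zp - Zq| ≤ Real.exp (-(t + 1)) * Zq) : |p - q| ≤ Real.exp (-t) * q := by
  set ε : ℝ := Real.exp (-t) with hε
  have hε0 : 0 < ε := Real.exp_pos _
  have hε1 : ε ≤ 1 := by rw [hε]; exact Real.exp_le_one_iff.mpr (by linarith)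
  -- `e^{-(t+1)} ≤ ε / 2` since `2 ≤ e`
  have hη : Real.exp (-(t + 1)) ≤ ε / 2 := by
    have h2 : (2 : ℝ) ≤ Real.exp 1 := by
      have := Real.add_one_le_exp (1 : ℝ); linarith
    have : Real.exp (-(t + 1)) = ε * (Real.exp 1)⁻¹ := by
      rw [hε, ← Real.exp_neg, ← Real.exp_add]; ring_nf
    rw [this]
    have hinv : (Real.exp 1)⁻¹ ≤ 1 / 2 := by
      rw [inv_eq_one_div]; exact one_div_le_one_div_of_le (by norm_num) h2
    calc ε * (Real.exp 1)⁻¹ ≤ ε * (1 / 2) := mul_le_mul_of_nonneg_left hinv hε0.le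
      _ = ε / 2 := by ring
  have hNZq : 0 ≤ N * Zq := mul_nonneg hN.le hZq
  have hNZp : 0 ≤ N * Zp := mul_nonneg hN.le hZp
  -- the three-term split
  have h1 : |p - q| ≤ |p - N * Zp| + N * |Zp - Zq| + |N * Zq - q| := by
    have hsplit : p - q = (p - N * Zp) + N * (Zp - Zq) + (N * Zq - q) := by ring
    calc |p - q| = |(p - N * Zp) + N * (Zp - Zq) + (N * Zq - q)| := by rw [← hsplit]
      _ ≤ |(p - N * Zp) + N * (Zp - Zq)| + |N * Zq - q| := abs_add_le _ _
      _ ≤ |p - N * Zp| + |N * (Zp - Zq)| + |N * Zq - q| := by gcongr; exact abs_add_le _ _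
      _ = |p - N * Zp| + N * |Zp - Zq| + |N * Zq - q| := by rw [abs_mul, abs_of_pos hN]
  have hq' : |N * Zq - q| ≤ ε / 8 * (N * Zq) := by rw [abs_sub_comm]; exact hq
  -- `N Zp ≤ (1 + ε/2) N Zq`
  have hZpq : N * Zp ≤ (1 + ε / 2) * (N * Zq) := by
    have h := (abs_le.mp (hZ.trans (mul_le_mul_of_nonneg_right hη hZq))).2
    nlinarith
  -- `q ≥ (1 − ε/8) N Zq`
  have hqlow : (1 - ε / 8) * (N * Zq) ≤ q := by
    have h := (abs_le.mp hq).1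
    nlinarith
  -- assemble
  have h2 : |p - q| ≤ (ε / 8 * (1 + ε / 2) + ε / 2 + ε / 8) * (N * Zq) := by
    calc |p - q| ≤ |p - N * Zp| + N * |Zp - Zq| + |N * Zq - q| := h1
      _ ≤ ε / 8 * (N * Zp) + N * (ε / 2 * Zq) + ε / 8 * (N * Zq) := by
          gcongr
          · exact hZ.trans (mul_le_mul_of_nonneg_right hη hZq)
      _ ≤ ε / 8 * ((1 + ε / 2) * (N * Zq)) + N * (ε / 2 * Zq) + ε / 8 * (N * Zq) := by
          gcongr
      _ = (ε / 8 * (1 + ε / 2) + ε / 2 + ε / 8) * (N * Zq) := by ring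
  -- `(ε/8(1+ε/2) + ε/2 + ε/8) ≤ (13/16) ε` and `N Zq ≤ q / (7/8)`
  have hcoef : ε / 8 * (1 + ε / 2) + ε / 2 + ε / 8 ≤ 13 / 16 * ε := by nlinarith
  have h3 : |p - q| ≤ 13 / 16 * ε * (N * Zq) :=
    h2.trans (mul_le_mul_of_nonneg_right hcoef hNZq)
  have h4 : 13 / 16 * ε * (N * Zq) ≤ ε * q := by
    -- `(7/8) N Zq ≤ (1 − ε/8) N Zq ≤ q`
    have h5 : 7 / 8 * (N * Zq) ≤ q := by nlinarith
    nlinarith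
  exact h3.trans h4

/-! ## B2, canonical half: the PEELING bound in the `w`-theory (N-independent) -/

section Canonical

variable {G H : Type} [Group G] [MeasurableSpace G] [Group H] [TopologicalSpace H]
  [IsTopologicalGroup H] [CompactSpace H] [MeasurableSpace H] [BorelSpace H]

/-- `e⁻² ≤ 1/2` (so the window rate `e^{−(2S+2)}` is an admissible defect `δ ≤ 1/2` for `eblind_thick_re`). -/
theorem exp_neg_two_S_two_le_half (S : ℕ) : Real.exp (-(2 * (S : ℝ) + 2)) ≤ 1 / 2 := by
  have h1 : Real.exp (-(2 * (S : ℝ) + 2)) ≤ Real.exp (-1) :=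
    Real.exp_le_exp.mpr (by have : (0:ℝ) ≤ S := Nat.cast_nonneg S; linarith)
  have h2 : Real.exp (-1) ≤ 1 / 2 := by
    have h := Real.add_one_le_exp (1 : ℝ)
    rw [Real.exp_neg, inv_eq_one_div]
    exact one_div_le_one_div_of_le (by norm_num) (by linarith)
  exact h1.trans h2

/-- **B2, canonical half (PEELING in the `w`-theory).**  At one split weight `w ≥ 0` with window equipartition beyond `S_e`, vacuum slack
`(C_T, S_T)` and the spectral dictionary `(thick, nrm ≥ 0, S_D)`: for `S ≥ max(S_e, S_T, S_D, 1)`, a species `A` in the peeling regime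
`4·thick A ≤ 2S+1`, a family base `z₀` and two electric parts `e, e'`,
`|W_A(z₀|e)·Z(z₀|e') − W_A(z₀|e')·Z(z₀|e)| ≤ 40·(nrm A·C_T)·e^{−(2S+2)}·Z(z₀|e)·Z(z₀|e')` (`Z = Z_w(·; 2S+1)`) — the tree theorem
`ThickSpeciesDatum.eblind_thick_re` over `Zc := Fin 3 → ker π` (abelian by centrality, finite by `(ker π).Finite`), fed with D's eigen-datum
at extents `2S+1 − thick A` and `2S+1`, EQUI from S3ʷ at both extents (rate `e^{−(2S+2)} ≤ 1/2`) between each member and `elOff z₀`, and the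
slack from T at `ϱ = thick A`. -/
theorem canonical_eblind (π : H →* G) (hker : π.ker ≤ Subgroup.center H) (hfin : (π.ker : Set H).Finite)
    {w : H → ℝ} (hw0 : ∀ h, 0 ≤ w h) {S_e : ℕ} (hEq : EquiWindowOn π w S_e) {C_T : ℝ} {S_T : ℕ}
    (hSl : VacuumSlackOn π w C_T S_T) {thick : YMSpecies G → ℕ} {nrm : YMSpecies G → ℝ} {S_D : ℕ}
    (hCT : 0 ≤ C_T) (hDi : SpectralDictOn π w thick nrm S_D) (A : YMSpecies G) (S : ℕ)
    (hS1 : 1 ≤ S)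
    (hSe : S_e ≤ S) (hST : S_T ≤ S) (hSD : S_D ≤ S) (hthick : 4 * thick A ≤ 2 * S + 1) (z₀ : Sector π)
    (e e' : Fin 3 → ↥π.ker) :
    |secW π w (withEl π z₀ e) S A * secZ π w (withEl π z₀ e') S (2 * S + 1) -
        secW π w (withEl π z₀ e') S A * secZ π w (withEl π z₀ e) S (2 * S + 1)| ≤
      40 * (nrm A * C_T) * Real.exp (-(2 * (S : ℝ) + 2)) *
        secZ π w (withEl π z₀ e) S (2 * S + 1) * secZ π w (withEl π z₀ e') S (2 * S + 1) := by
  -- instances on the electric twist group `Fin 3 → ker π`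
  haveI : Finite ↥π.ker := hfin.to_subtype
  letI : Fintype ↥π.ker := Fintype.ofFinite _
  letI : CommGroup ↥π.ker :=
    { (inferInstance : Group ↥π.ker) with
      mul_comm := fun a b => Subtype.ext (Subgroup.mem_center_iff.mp (hker b.2) a) }
  -- unpack the dictionary at `(S, z₀)`
  obtain ⟨ι, lam, χ, hlam, hmul, hnorm1, hZs, hAs⟩ := hDi S hSD z₀
  obtain ⟨d, hnrm, hd, hWs⟩ := hAs A hthick
  set t : ℕ := 2 * S + 1 with ht
  set ϱ : ℕ := thick A with hϱ
  set Λ : ℝ := growthRate π w z₀ S with hΛ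
  have hsϱ : 2 ≤ t - ϱ := by omega
  have h3 : 3 * (2 * S + 1) ≤ 4 * (t - ϱ) := by omega
  have h4 : t - ϱ ≤ 2 * S + 1 := by omega
  have h1 : ∀ i, χ i 1 = 1 := fun i => ThickSpeciesDatum.char_one (χ i) (hmul i) (hnorm1 i)
  -- the data at extent `t − ϱ` (block X) and `t` (block Z)
  set X₁ : ℝ := secZ π w (withEl π z₀ 1) S (t - ϱ) with hX₁
  set Z₀ : ℝ := secZ π w (withEl π z₀ 1) S t with hZ₀
  have hX1 : HasSum (fun i => lam i ^ (t - ϱ)) X₁ := by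
    have h := hZs (t - ϱ) hsϱ 1
    simp only [h1, one_mul] at h
    exact Complex.hasSum_ofReal.mp h
  have hZ1 : HasSum (fun i => lam i ^ t) Z₀ := by
    have h := hZs t (by omega) 1
    simp only [h1, one_mul] at h
    exact Complex.hasSum_ofReal.mp h
  have hZ₀0 : 0 ≤ Z₀ := secZ_nonneg π hw0 _ _ _
  -- equipartition at both extents (S3ʷ), as complex-norm statements about the real casts
  have hequiX : ∀ c : Fin 3 → ↥π.ker,
      ‖((secZ π w (withEl π z₀ c) S (t - ϱ) : ℝ) : ℂ) - (X₁ : ℂ)‖ ≤ Real.exp (-(2 * (S : ℝ) + 2)) * X₁ := by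
    intro c
    rw [← Complex.ofReal_sub, Complex.norm_real, Real.norm_eq_abs]
    exact hEq S hSe (t - ϱ) h3 h4 (withEl π z₀ c) (withEl π z₀ 1) (withEl_related π z₀ c 1)
  have hequiZ : ∀ c : Fin 3 → ↥π.ker,
      ‖((secZ π w (withEl π z₀ c) S t : ℝ) : ℂ) - (Z₀ : ℂ)‖ ≤ Real.exp (-(2 * (S : ℝ) + 2)) * Z₀ := by
    intro c
    rw [← Complex.ofReal_sub, Complex.norm_real, Real.norm_eq_abs]
    exact hEq S hSe t (by omega) le_rfl (withEl π z₀ c) (withEl π z₀ 1) (withEl_related π z₀ c 1)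
  -- the slack (T) at `ϱ = thick A`
  have hslack : (nrm A * Λ ^ ϱ) * X₁ ≤ (nrm A * C_T) * Z₀ := by
    have h := hSl S hST z₀ ϱ hthick
    -- `elOff z₀ = withEl z₀ 1` by definition
    have hX₁' : secZ π w (elOff π z₀) S (2 * S + 1 - ϱ) = X₁ := rfl
    have hZ₀' : secZ π w (elOff π z₀) S (2 * S + 1) = Z₀ := rfl
    rw [hX₁', hZ₀'] at h
    calc (nrm A * Λ ^ ϱ) * X₁ = nrm A * (Λ ^ ϱ * X₁) := by ring
      _ ≤ nrm A * (C_T * Z₀) := mul_le_mul_of_nonneg_left h hnrm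
      _ = (nrm A * C_T) * Z₀ := by ring
  have hδ0 : 0 ≤ Real.exp (-(2 * (S : ℝ) + 2)) := (Real.exp_pos _).le
  have hK : 0 ≤ nrm A * C_T := mul_nonneg hnrm hCT
  have hmain := ThickSpeciesDatum.eblind_thick_re (Zc := Fin 3 → ↥π.ker) (fun i => lam i ^ (t - ϱ))
    (fun i => pow_nonneg (hlam i).1 _) χ hmul hnorm1 d hd (fun c => hZs (t - ϱ) hsϱ c) hX1 hWs hequiX hZ₀0 hequiZ
    hδ0 (exp_neg_two_S_two_le_half S) hK hslack e e'
  have hre : ∀ c : Fin 3 → ↥π.ker, (((secZ π w (withEl π z₀ c) S t : ℝ) : ℂ)).re = secZ π w (withEl π z₀ c) S t :=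
    fun c => Complex.ofReal_re _
  rw [hre, hre, ← Complex.ofReal_mul, ← Complex.ofReal_mul, ← Complex.ofReal_sub, Complex.norm_real,
    Real.norm_eq_abs] at hmain
  exact hmain

end Canonical

/-! ## B2, canonical half (continued): the insertion bound `|W_A(z₀|e)| ≤ 2·(nrm A·C_T)·Z(z₀|e)` -/

section CanonicalW

variable {G H : Type} [Group G] [MeasurableSpace G] [Group H] [TopologicalSpace H]
  [IsTopologicalGroup H] [CompactSpace H] [MeasurableSpace H] [BorelSpace H]

/-- **Twisted insertion bound** from D + T + S3ʷ: `|W_A(z₀|e)| ≤ nrm A·λ₊^{ϱ}·Z(elOff z₀; t−ϱ) ≤ nrm A·C_T·Z(elOff z₀; t) ≤ 2·nrm A·C_T·Z(z₀|e; t)`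
(`‖χᵢ(e)‖ = 1`, `‖dᵢ‖ ≤ nrm A·λ₊^ϱ`; slack; `Z₀ ≤ 2 Z_e` from the window EQUI at rate `≤ 1/2`). -/
theorem abs_secW_le (π : H →* G) {w : H → ℝ} (hw0 : ∀ h, 0 ≤ w h) {S_e : ℕ} (hEq : EquiWindowOn π w S_e)
    {C_T : ℝ} {S_T : ℕ} (hSl : VacuumSlackOn π w C_T S_T) (hCT : 0 ≤ C_T) {thick : YMSpecies G → ℕ}
    {nrm : YMSpecies G → ℝ} {S_D : ℕ} (hDi : SpectralDictOn π w thick nrm S_D) (A : YMSpecies G)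
    (hker : π.ker ≤ Subgroup.center H)
    (S : ℕ) (hS1 : 1 ≤ S) (hSe : S_e ≤ S) (hST : S_T ≤ S) (hSD : S_D ≤ S) (hthick : 4 * thick A ≤ 2 * S + 1)
    (z₀ : Sector π) (e : Fin 3 → ↥π.ker) :
    |secW π w (withEl π z₀ e) S A| ≤ 2 * (nrm A * C_T) * secZ π w (withEl π z₀ e) S (2 * S + 1) := by
  letI : CommGroup ↥π.ker :=
    { (inferInstance : Group ↥π.ker) with
      mul_comm := fun a b => Subtype.ext (Subgroup.mem_center_iff.mp (hker b.2) a) }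
  obtain ⟨ι, lam, χ, hlam, hmul, hnorm1, hZs, hAs⟩ := hDi S hSD z₀
  obtain ⟨d, hnrm, hd, hWs⟩ := hAs A hthick
  set t : ℕ := 2 * S + 1 with ht
  set ϱ : ℕ := thick A with hϱ
  set Λ : ℝ := growthRate π w z₀ S with hΛ
  have hsϱ : 2 ≤ t - ϱ := by omega
  have h3 : 3 * (2 * S + 1) ≤ 4 * (t - ϱ) := by omega
  have h1 : ∀ i, χ i 1 = 1 := fun i => ThickSpeciesDatum.char_one (χ i) (hmul i) (hnorm1 i)
  set X₁ : ℝ := secZ π w (withEl π z₀ 1) S (t - ϱ) with hX₁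
  set Z₀ : ℝ := secZ π w (withEl π z₀ 1) S t with hZ₀
  set Ze : ℝ := secZ π w (withEl π z₀ e) S t with hZe
  have hX1 : HasSum (fun i => lam i ^ (t - ϱ)) X₁ := by
    have h := hZs (t - ϱ) hsϱ 1
    simp only [h1, one_mul] at h
    exact Complex.hasSum_ofReal.mp h
  have hZ₀0 : 0 ≤ Z₀ := secZ_nonneg π hw0 _ _ _
  -- Step 1: `‖W e‖ ≤ (nrm A · Λ^ϱ) · X₁` termwise
  have hWnorm : ‖((secW π w (withEl π z₀ e) S A : ℝ) : ℂ)‖ ≤ (nrm A * Λ ^ ϱ) * X₁ := by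
    refine (hWs e).norm_le_of_bounded (hX1.mul_left (nrm A * Λ ^ ϱ)) (fun i => ?_)
    rw [norm_mul, norm_mul, hnorm1, one_mul, Complex.norm_real, Real.norm_eq_abs,
      abs_of_nonneg (pow_nonneg (hlam i).1 _), mul_comm]
    exact mul_le_mul_of_nonneg_right (hd i) (pow_nonneg (hlam i).1 _)
  rw [Complex.norm_real, Real.norm_eq_abs] at hWnorm
  -- Step 2: slack `Λ^ϱ X₁ ≤ C_T Z₀`
  have hslack : (nrm A * Λ ^ ϱ) * X₁ ≤ (nrm A * C_T) * Z₀ := by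
    have h := hSl S hST z₀ ϱ hthick
    have hX₁' : secZ π w (elOff π z₀) S (2 * S + 1 - ϱ) = X₁ := rfl
    have hZ₀' : secZ π w (elOff π z₀) S (2 * S + 1) = Z₀ := rfl
    rw [hX₁', hZ₀'] at h
    calc (nrm A * Λ ^ ϱ) * X₁ = nrm A * (Λ ^ ϱ * X₁) := by ring
      _ ≤ nrm A * (C_T * Z₀) := mul_le_mul_of_nonneg_left h hnrm
      _ = (nrm A * C_T) * Z₀ := by ring
  -- Step 3: `Z₀ ≤ 2 Ze` from EQUI at extent `t` (rate ≤ 1/2)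
  have hZ2 : Z₀ ≤ 2 * Ze := by
    have h := hEq S hSe t (by omega) le_rfl (withEl π z₀ e) (withEl π z₀ 1) (withEl_related π z₀ e 1)
    have hhalf := exp_neg_two_S_two_le_half S
    have hlow := (abs_le.mp h).1
    -- `Ze − Z₀ ≥ −e^{−(2S+2)} Z₀ ≥ −Z₀/2`
    have : Real.exp (-(2 * (S : ℝ) + 2)) * Z₀ ≤ 1 / 2 * Z₀ := mul_le_mul_of_nonneg_right hhalf hZ₀0
    simp only [hZe, ht]
    linarith
  calc |secW π w (withEl π z₀ e) S A| ≤ (nrm A * Λ ^ ϱ) * X₁ := hWnorm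
    _ ≤ (nrm A * C_T) * Z₀ := hslack
    _ ≤ (nrm A * C_T) * (2 * Ze) := mul_le_mul_of_nonneg_left hZ2 (mul_nonneg hnrm hCT)
    _ = 2 * (nrm A * C_T) * secZ π w (withEl π z₀ e) S (2 * S + 1) := by simp only [hZe, ht]; ring

/-- The species size `nrm A` is non-negative wherever the dictionary provides a species clause (its `0 ≤ nrm A` conjunct). -/
theorem nrm_nonneg_of_spectralDictOn (π : H →* G) {w : H → ℝ} {thick : YMSpecies G → ℕ} {nrm : YMSpecies G → ℝ}
    {S_D : ℕ} (hDi : SpectralDictOn π w thick nrm S_D) (A : YMSpecies G) (S : ℕ) (hSD : S_D ≤ S)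
    (hthick : 4 * thick A ≤ 2 * S + 1) (z₀ : Sector π) : 0 ≤ nrm A := by
  obtain ⟨ι, lam, χ, -, -, -, -, hAs⟩ := hDi S hSD z₀
  obtain ⟨d, hnrm, -, -⟩ := hAs A hthick
  exact hnrm

end CanonicalW

/-! ## B2, transport half: pure real bookkeeping -/
set_option maxHeartbeats 400000 in
/-- **Cross-difference transport through the label noise.**  Weights `p = N·Z + r`, `p' = N·Z' + r'` (`|r| ≤ νNZ`, `|r'| ≤ νNZ'`),
integrals `I = N·W + J·p + q`, `I' = N·W' + J·p' + q'` (`|q| ≤ νC·NZ`, `|q'| ≤ νC·NZ'` — `J` anchored on the weight, so it cancels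
identically), the canonical cross bound `|W·Z' − W'·Z| ≤ M·Z·Z'` and the insertion bounds `|W| ≤ 2K·Z`, `|W'| ≤ 2K·Z'`, with `ν ≤ 1/8`,
give `|p'·I − p·I'| ≤ 2·(M + 4Kν + 4Cν)·p·p'`. -/
theorem cross_transport {p p' I I' W W' Z Z' N J ν C K M : ℝ}
    (hZ : 0 ≤ Z) (hZ' : 0 ≤ Z') (hN : 0 ≤ N) (hν0 : 0 ≤ ν) (hν : ν ≤ 1 / 8)
    (hC : 0 ≤ C) (hK : 0 ≤ K) (hM : 0 ≤ M)
    (hpe : |p - N * Z| ≤ ν * (N * Z)) (hpe' : |p' - N * Z'| ≤ ν * (N * Z'))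
    (hI : |I - (N * W + J * p)| ≤ ν * C * (N * Z)) (hI' : |I' - (N * W' + J * p')| ≤ ν * C * (N * Z'))
    (hcross : |W * Z' - W' * Z| ≤ M * Z * Z') (hW : |W| ≤ 2 * K * Z) (hW' : |W'| ≤ 2 * K * Z') :
    |p' * I - p * I'| ≤ 2 * (M + 4 * K * ν + 4 * C * ν) * (p * p') := by
  have hNZ : 0 ≤ N * Z := mul_nonneg hN hZ
  have hNZ' : 0 ≤ N * Z' := mul_nonneg hN hZ'
  -- weights are ≥ (1 − ν) N Z ≥ 0, in particular ≥ (7/8) N Z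
  have hp_low : 7 / 8 * (N * Z) ≤ p := by have := (abs_le.mp hpe).1; nlinarith
  have hp'_low : 7 / 8 * (N * Z') ≤ p' := by have := (abs_le.mp hpe').1; nlinarith
  have hp0 : 0 ≤ p := le_trans (by positivity) hp_low
  have hp0' : 0 ≤ p' := le_trans (by positivity) hp'_low
  have hp_up : p ≤ 9 / 8 * (N * Z) := by have := (abs_le.mp hpe).2; nlinarith
  have hp'_up : p' ≤ 9 / 8 * (N * Z') := by have := (abs_le.mp hpe').2; nlinarith
  -- decomposition: `p' I − p I' = N·(p' W − p W') + (p' q − p q')`, `p' W − p W' = N(Z' W − Z W') + r' W − r W'`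
  set r : ℝ := p - N * Z with hr
  set r' : ℝ := p' - N * Z' with hr'
  set q : ℝ := I - (N * W + J * p) with hq
  set q' : ℝ := I' - (N * W' + J * p') with hq'
  have key : p' * I - p * I' = N * (N * (Z' * W - Z * W') + (r' * W - r * W')) + (p' * q - p * q') := by
    simp only [hr, hr', hq, hq']; ring
  rw [key]
  have h1 : |N * (Z' * W - Z * W')| ≤ N * (M * Z * Z') := by
    rw [abs_mul, abs_of_nonneg hN]
    refine mul_le_mul_of_nonneg_left ?_ hN
    have : Z' * W - Z * W' = W * Z' - W' * Z := by ring
    rw [this]; exact hcross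
  have h2 : |r' * W| ≤ ν * (N * Z') * (2 * K * Z) := by
    rw [abs_mul]; exact mul_le_mul hpe' hW (abs_nonneg _) (mul_nonneg hν0 hNZ')
  have h3 : |r * W'| ≤ ν * (N * Z) * (2 * K * Z') := by
    rw [abs_mul]; exact mul_le_mul hpe hW' (abs_nonneg _) (mul_nonneg hν0 hNZ)
  have h4 : |p' * q| ≤ (9 / 8 * (N * Z')) * (ν * C * (N * Z)) := by
    rw [abs_mul, abs_of_nonneg hp0']; exact mul_le_mul hp'_up hI (abs_nonneg _) (by positivity)
  have h5 : |p * q'| ≤ (9 / 8 * (N * Z)) * (ν * C * (N * Z')) := by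
    rw [abs_mul, abs_of_nonneg hp0]; exact mul_le_mul hp_up hI' (abs_nonneg _) (by positivity)
  have hsum : |N * (N * (Z' * W - Z * W') + (r' * W - r * W')) + (p' * q - p * q')| ≤
      N * (N * (M * Z * Z') + (ν * (N * Z') * (2 * K * Z) + ν * (N * Z) * (2 * K * Z'))) +
        ((9 / 8 * (N * Z')) * (ν * C * (N * Z)) + (9 / 8 * (N * Z)) * (ν * C * (N * Z'))) := by
    refine (abs_add_le _ _).trans (add_le_add ?_ ?_)
    · rw [abs_mul, abs_of_nonneg hN]
      refine mul_le_mul_of_nonneg_left ?_ hN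
      refine (abs_add_le _ _).trans (add_le_add h1 ?_)
      exact (abs_sub _ _).trans (add_le_add h2 h3)
    · exact (abs_sub _ _).trans (add_le_add h4 h5)
  refine hsum.trans ?_
  -- everything is a multiple of `(N Z)(N Z')`; compare with `p p' ≥ (7/8)² (N Z)(N Z')`
  have hprod : (N * Z) * (N * Z') ≤ 64 / 49 * (p * p') := by
    have := mul_le_mul hp_low hp'_low (by positivity) hp0
    nlinarith
  have hcoef : 0 ≤ M + 4 * K * ν + 9 / 4 * C * ν := by positivity
  calc N * (N * (M * Z * Z') + (ν * (N * Z') * (2 * K * Z) + ν * (N * Z) * (2 * K * Z'))) +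
        ((9 / 8 * (N * Z')) * (ν * C * (N * Z)) + (9 / 8 * (N * Z)) * (ν * C * (N * Z')))
      = (M + 4 * K * ν + 9 / 4 * C * ν) * ((N * Z) * (N * Z')) := by ring
    _ ≤ (M + 4 * K * ν + 9 / 4 * C * ν) * (64 / 49 * (p * p')) := mul_le_mul_of_nonneg_left hprod hcoef
    _ ≤ 2 * (M + 4 * K * ν + 4 * C * ν) * (p * p') := by
        have hpp : 0 ≤ p * p' := mul_nonneg hp0 hp0'
        nlinarith [mul_nonneg (mul_nonneg hC hν0) hpp, mul_nonneg hM hpp, mul_nonneg (mul_nonneg hK hν0) hpp]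


end Summit.QuantumFields.YangMills.Cruxes.IRcof.EquipartitionSeam.KernelBridges

end
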